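import Literature.AlgebraicGeometry.GroupSchemes.HopfIdealOfClosedSubgroup               -- ★ p845070 B-p12 (g31) (o-c3m-a): the ideal of a closed subgroup is a Hopf ideal
import Literature.AlgebraicGeometry.GroupSchemes.BTGroupConnectedDimOneOfTangentRank      -- ★ p845068: `finrank_alg_eq_finrank_hom` (brings ★ p845010 §1 model lemmas)
import Literature.RingTheory.HopfAlgebra.MonogenicLocalHopfIdeals                        -- ★ μ4 p844994∕p845006: coideals of a monogenic local bialgebra are `𝔪^{p^i}`
import HarnessLib

/-!
# Closed subgroup schemes of a connected one-dimensional layer are the Frobenius kernels — (μ4) in scheme dress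
# ([Harris–Taylor 2001] Lemma II.2.1 (2); [Tate 1997] (3.7))

Topic `Literature/AlgebraicGeometry/GroupSchemes`; namespace `Literature.AlgebraicGeometry.GroupSchemes`.  THEOREMS ONLY (no definition, no named
fact, no instance, no notation, no `sorry`).  Cell `hodgecm-mathlib`, P6 «MOD programme», DICT organ **(o-c3m)** (F0P6c-plan (g0), 2026-09-01 14:45Z):
for a finite group scheme `G` over a field `k` of characteristic `p` whose algebra is MONOGENIC, `θ : k[X]⧸(X^{p^N}) ≃ₐ[k] Γ(G, 𝒪_G)` (the layers
`B.G n` of a connected one-dimensional BT group, `N = nH`: ★ `BTGroupConnectedDimOneCoordinates.exists_naturalCoordinates_of_isConnectedDimOne`, or ★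
`BTGroupConnectedDimOneOfTangentRank`), EVERY CLOSED SUBGROUP SCHEME `i : K ↪ G` has ideal `(θ(X̄)^{p^j})` for a unique `j ≤ N` and rank `p^j`; hence
two closed subgroup schemes of the same rank have the SAME ideal (and are isomorphic over `G`), and there is exactly one of each rank `p^j`, `j ≤ N` —
in print «`ker F^j`» ([HarrisTaylorAMS2001] II.2.1 (2): «for any `t` it contains a unique finite flat subgroup scheme of order `p^t`, namely `ker F^t`»).
Assembly of ★ (o-c3m-a) `AffineGroupScheme.isHopfIdeal_ker_of_closedSubgroup` (B-p12: the ideal of a closed subgroup, read as the kernel of the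
algebra map of its tautological point, is a HOPF IDEAL of `Γ(G)` with its ★ `Alg.instHopfAlgebra`), ★ (μ4) `MonogenicLocalHopfIdeals.exists_eq_maximalIdeal_pow_prime_pow`
(F0P6-p16: every coideal of a local module-finite bialgebra with principal `𝔪` is `𝔪^{p^i}`), the ★ model lemmas of `BTGroupConnectedDimOneCoordinates`
§1 (`𝔪 = (θ X̄)`, locality, dimension) and ★ `exists_algEquiv_quotient_ker` (`Γ(G)⧸I ≃ Γ(K)`).  CONSUMERS: DICT fields (b)∕(c3c) at SUPERSINGULAR
points («every rank-`q` closed subgroup of the connected `𝒜_x̄[𝔴]` is THE one» = `ker F_q` by P6d HLBT), HEART, P6b (b4) uniqueness.  HC_CM is proved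
only modulo the printed citations until rung 0 closes; nothing here is about HC.

MAIN STATEMENTS.  §1 (pure algebra, `A` any commutative `k`-bialgebra with `θ : k[X]⧸(X^{p^N}) ≃ₐ[k] A`): **`exists_le_eq_span_pow_of_isCoideal`**
(every coideal is `(θ(X̄)^{p^j})`, `j ≤ N`), `finrank_quotient_span_pow_eq` (`dim_k A⧸(θ(X̄)^m) = m` for `m ≤ p^N`), `span_pow_injective`;
§2 (schemes) **`exists_ker_eq_span_pow_of_closedSubgroup`** (ideal `= (θ(X̄)^{p^j})`, `j ≤ N`, `dim_k Γ(K) = p^j`), **`finrank_hom_eq_of_closedSubgroup`**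
(the `Scheme.Hom.finrank` form), **`ker_eq_ker_of_finrank_alg_eq`** (same rank ⇒ same ideal) and `exists_iso_of_finrank_alg_eq` (⇒ isomorphic over `G`).

## References
* [HarrisTaylorAMS2001] M. Harris, R. Taylor, *The Geometry and Cohomology of Some Simple Shimura Varieties* (2001) — §II.2, Lemma II.2.1 (2), p. 73.
* [Tate1997FiniteFlatGroupSchemes] J. Tate, *Finite flat group schemes* (1997) — §3, (3.7).
* [Waterhouse1979] W. C. Waterhouse, *Introduction to Affine Group Schemes*, GTM 66 (1979) — §2.1 (closed subgroups ↔ Hopf ideals).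
-/

set_option autoImplicit false

-- Mathlib's `Over`/`Scheme` APIs are stated across semireducible wrappers (as in the ★ `GroupSchemes/*` files).
set_option backward.isDefEq.respectTransparency false

noncomputable section

universe u v

open AlgebraicGeometry CategoryTheory Polynomial IsLocalRing

namespace Literature.AlgebraicGeometry.GroupSchemes

/-! ## §1 Algebra: coideals of a bialgebra `A ≃ₐ[k] k[X]⧸(X^{p^N})` are the `(x^{p^j})`, of codimension `p^j` -/

section Algebra

variable {k : Type u} [Field k] {p : ℕ} [hp : Fact p.Prime] [CharP k p] {A : Type v} [CommRing A] [Bialgebra k A] {N : ℕ}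

/-- **Every COIDEAL of a commutative `k`-bialgebra `A ≃ₐ[k] k[X]⧸(X^{p^N})` (`char k = p`) is `(x^{p^j})` for some `j ≤ N`**, `x = θ(X̄)` (★ μ4
`exists_eq_maximalIdeal_pow_prime_pow` — `A` is local, module-finite, with principal `𝔪 = (x)` by ★ `BTGroupConnectedDimOneCoordinates` §1 — and `𝔪^{p^i} = (x^{p^i})`,
capped at `N` since `x^{p^N} = 0`). [cite: HarrisTaylorAMS2001, Lemma II.2.1 (2)] [cite: Tate1997FiniteFlatGroupSchemes, (3.7)] -/
theorem exists_le_eq_span_pow_of_isCoideal (θ : (k[X] ⧸ Ideal.span {(X : k[X]) ^ (p ^ N)}) ≃ₐ[k] A) (I : Ideal A)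
    (hI : (I.restrictScalars k).IsCoideal) : ∃ j ≤ N, I = Ideal.span {θ (Ideal.Quotient.mk _ X) ^ (p ^ j)} := by
  have hN : p ^ N ≠ 0 := pow_ne_zero _ hp.out.ne_zero
  haveI : IsLocalRing A := isLocalRing_of_algEquiv_quotient_X_pow θ.symm hN
  haveI : Module.Finite k A :=
    Module.finite_of_finrank_pos (by rw [finrank_eq_of_algEquiv_quotient_X_pow θ.symm]; exact Nat.pos_of_ne_zero hN)
  have h𝔪 : maximalIdeal A = Ideal.span {θ (Ideal.Quotient.mk _ X)} := by
    rw [maximalIdeal_eq_span_of_algEquiv_quotient_X_pow θ.symm, AlgEquiv.symm_symm]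
  obtain ⟨i, hi⟩ := Literature.RingTheory.HopfAlgebra.exists_eq_maximalIdeal_pow_prime_pow (k := k) (p := p)
    ⟨θ (Ideal.Quotient.mk _ X), by rw [h𝔪, Ideal.submodule_span_eq]⟩ I hI
  rw [h𝔪, Ideal.span_singleton_pow] at hi
  by_cases hiN : i ≤ N
  · exact ⟨i, hiN, hi⟩
  · -- beyond `N` the ideal is `⊥ = (x^{p^N})`
    have hx : θ (Ideal.Quotient.mk _ X) ^ (p ^ N) = 0 := by
      have h := symm_mk_X_pow_eq_zero θ.symm
      rwa [AlgEquiv.symm_symm] at h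
    refine ⟨N, le_rfl, ?_⟩
    rw [hi, Ideal.span_singleton_eq_bot.mpr hx, Ideal.span_singleton_eq_bot.mpr]
    exact pow_eq_zero_of_le (Nat.pow_le_pow_right hp.out.pos (not_le.mp hiN).le) hx

omit hp [CharP k p] [Bialgebra k A] in
/-- **`dim_k A⧸(x^m) = m`** for `m ≤ p^N`, `x = θ(X̄)`: `A⧸(x^m) ≃ (k[X]⧸(X^{p^N}))⧸(X̄^m) ≃ k[X]⧸(X^m)` (Mathlib `Ideal.quotientEquivAlg`, third isomorphism
`DoubleQuot.quotQuotEquivQuotOfLEₐ`, `finrank_quotient_span_eq_natDegree`). [cite: HarrisTaylorAMS2001, Lemma II.2.1 (2)] -/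
theorem finrank_quotient_span_pow_eq [Algebra k A] (θ : (k[X] ⧸ Ideal.span {(X : k[X]) ^ (p ^ N)}) ≃ₐ[k] A) {m : ℕ} (hm : m ≤ p ^ N) :
    Module.finrank k (A ⧸ Ideal.span {θ (Ideal.Quotient.mk _ X) ^ m}) = m := by
  have hle : Ideal.span {(X : k[X]) ^ (p ^ N)} ≤ Ideal.span {(X : k[X]) ^ m} :=
    Ideal.span_singleton_le_span_singleton.mpr (pow_dvd_pow X hm)
  -- `A ⧸ (x^m) ≃ₐ[k] (k[X]⧸(X^{p^N})) ⧸ (X̄^m)`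
  have hmap : Ideal.span {θ (Ideal.Quotient.mk _ X) ^ m} =
      (Ideal.map (Ideal.Quotient.mkₐ k (Ideal.span {(X : k[X]) ^ (p ^ N)})) (Ideal.span {(X : k[X]) ^ m})).map (θ : _ →+* A) := by
    rw [Ideal.map_span, Ideal.map_span, Set.image_singleton, Set.image_singleton, map_pow, Ideal.Quotient.mkₐ_eq_mk, map_pow]
    rfl
  let e₁ := (Ideal.quotientEquivAlg _ _ θ hmap).symm
  let e₂ := DoubleQuot.quotQuotEquivQuotOfLEₐ k hle
  rw [(e₁.trans e₂).toLinearEquiv.finrank_eq, finrank_quotient_span_eq_natDegree, natDegree_X_pow]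

omit hp [CharP k p] [Bialgebra k A] in
/-- The exponent is determined by the ideal: `(x^{p^j}) = (x^{p^j′})` with `j, j′ ≤ N` forces `j = j′` (compare codimensions). [cite: Tate1997FiniteFlatGroupSchemes, (3.7)] -/
theorem pow_exponent_injective [Algebra k A] (hp2 : 2 ≤ p) (θ : (k[X] ⧸ Ideal.span {(X : k[X]) ^ (p ^ N)}) ≃ₐ[k] A) {j j' : ℕ} (hj : j ≤ N)
    (hj' : j' ≤ N) (h : Ideal.span {θ (Ideal.Quotient.mk _ X) ^ (p ^ j)} = Ideal.span {θ (Ideal.Quotient.mk _ X) ^ (p ^ j')}) : j = j' := by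
  have h1 := finrank_quotient_span_pow_eq θ (Nat.pow_le_pow_right (by omega) hj)
  have h2 := finrank_quotient_span_pow_eq θ (Nat.pow_le_pow_right (by omega) hj')
  have h12 : p ^ j = p ^ j' := by rw [← h1, ← h2, (Ideal.quotientEquivAlgOfEq k h).toLinearEquiv.finrank_eq]
  exact Nat.pow_right_injective hp2 h12

end Algebra

/-! ## §2 Schemes: closed subgroup schemes of a monogenic layer -/

section Scheme

variable {k : Type u} [Field k] {p : ℕ} [hp : Fact p.Prime] [CharP k p]
  {K G : Over (Spec (.of k))} [GrpObj K] [GrpObj G] [IsAffine K.left] [IsAffine G.left] {N : ℕ}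

/-- **CLOSED SUBGROUP SCHEMES OF A MONOGENIC LAYER ARE CUT OUT BY `(x^{p^j})`.**  `k` a field of characteristic `p`, `G` an affine group scheme
over `k` with `θ : k[X]⧸(X^{p^N}) ≃ₐ[k] Γ(G, 𝒪_G)` (a layer of a connected one-dimensional BT group), `i : K ↪ G` a closed subgroup scheme
(`IsMonHom i`, `IsClosedImmersion i.left`).  Then the ideal of `K` — the kernel of the algebra map of its tautological point (B-p04's ∕ (o-c3m-a)'s
currency; `= Γ(i)` by ★ `ptEquiv_isoSpecOver_inv_comp_apply`) — is `(θ(X̄)^{p^j})` for a unique `j ≤ N`, and `dim_k Γ(K, 𝒪_K) = p^j`.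
[cite: HarrisTaylorAMS2001, Lemma II.2.1 (2)] [cite: Waterhouse1979, §2.1] -/
theorem exists_ker_eq_span_pow_of_closedSubgroup (θ : (k[X] ⧸ Ideal.span {(X : k[X]) ^ (p ^ N)}) ≃ₐ[k] AffineGroupScheme.Alg G)
    (i : K ⟶ G) [IsMonHom i] [IsClosedImmersion i.left] :
    ∃ j ≤ N,
      RingHom.ker (AffineGroupScheme.ptEquiv G (AffineGroupScheme.Alg K) ((AffineGroupScheme.isoSpecOver K).inv ≫ i)).toRingHom =
          Ideal.span {θ (Ideal.Quotient.mk _ X) ^ (p ^ j)} ∧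
        Module.finrank k (AffineGroupScheme.Alg K) = p ^ j := by
  haveI := AffineGroupScheme.isHopfIdeal_ker_of_closedSubgroup (R := k) i
  obtain ⟨j, hj, hI⟩ := exists_le_eq_span_pow_of_isCoideal θ _
    (Ideal.IsHopfIdeal.toIsCoideal (R := k)
      (I := RingHom.ker (AffineGroupScheme.ptEquiv G (AffineGroupScheme.Alg K) ((AffineGroupScheme.isoSpecOver K).inv ≫ i)).toRingHom))
  refine ⟨j, hj, hI, ?_⟩
  obtain ⟨e, -⟩ := AffineGroupScheme.exists_algEquiv_quotient_ker (R := k) i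
  rw [← e.toLinearEquiv.finrank_eq, (Ideal.quotientEquivAlgOfEq k hI).toLinearEquiv.finrank_eq]
  exact finrank_quotient_span_pow_eq θ (Nat.pow_le_pow_right hp.out.pos hj)

/-- **The same with the rank of `K → Spec k`** (Mathlib `Scheme.Hom.finrank`; ★ `finrank_alg_eq_finrank_hom`): a closed subgroup scheme of a monogenic
layer `G ≅ Spec k[X]⧸(X^{p^N})` has rank `p^j`, `j ≤ N`, and ideal `(θ(X̄)^{p^j})`. [cite: HarrisTaylorAMS2001, Lemma II.2.1 (2)] [cite: Tate1997FiniteFlatGroupSchemes, (3.7)] -/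
theorem exists_ker_eq_span_pow_finrank_hom_eq_of_closedSubgroup (θ : (k[X] ⧸ Ideal.span {(X : k[X]) ^ (p ^ N)}) ≃ₐ[k] AffineGroupScheme.Alg G)
    (i : K ⟶ G) [IsMonHom i] [IsClosedImmersion i.left] [IsFinite K.hom] [Flat K.hom] (pt : Spec (.of k)) :
    ∃ j ≤ N,
      RingHom.ker (AffineGroupScheme.ptEquiv G (AffineGroupScheme.Alg K) ((AffineGroupScheme.isoSpecOver K).inv ≫ i)).toRingHom =
          Ideal.span {θ (Ideal.Quotient.mk _ X) ^ (p ^ j)} ∧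
        K.hom.finrank pt = p ^ j := by
  obtain ⟨j, hj, hI, hrk⟩ := exists_ker_eq_span_pow_of_closedSubgroup θ i
  exact ⟨j, hj, hI, by rw [← finrank_alg_eq_finrank_hom K pt, hrk]⟩

/-- **TWO CLOSED SUBGROUP SCHEMES OF THE SAME RANK HAVE THE SAME IDEAL** — at most one closed subgroup scheme of each order in a monogenic layer
(«the unique one of order `p^t` is `ker F^t`»). [cite: HarrisTaylorAMS2001, Lemma II.2.1 (2)] [cite: Tate1997FiniteFlatGroupSchemes, (3.7)] -/
theorem ker_eq_ker_of_finrank_alg_eq (θ : (k[X] ⧸ Ideal.span {(X : k[X]) ^ (p ^ N)}) ≃ₐ[k] AffineGroupScheme.Alg G)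
    {K' : Over (Spec (.of k))} [GrpObj K'] [IsAffine K'.left]
    (i : K ⟶ G) [IsMonHom i] [IsClosedImmersion i.left] (i' : K' ⟶ G) [IsMonHom i'] [IsClosedImmersion i'.left]
    (h : Module.finrank k (AffineGroupScheme.Alg K) = Module.finrank k (AffineGroupScheme.Alg K')) :
    RingHom.ker (AffineGroupScheme.ptEquiv G (AffineGroupScheme.Alg K) ((AffineGroupScheme.isoSpecOver K).inv ≫ i)).toRingHom =
      RingHom.ker (AffineGroupScheme.ptEquiv G (AffineGroupScheme.Alg K') ((AffineGroupScheme.isoSpecOver K').inv ≫ i')).toRingHom := by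
  obtain ⟨j, hj, hI, hrk⟩ := exists_ker_eq_span_pow_of_closedSubgroup θ i
  obtain ⟨j', hj', hI', hrk'⟩ := exists_ker_eq_span_pow_of_closedSubgroup θ i'
  have hjj : j = j' := Nat.pow_right_injective hp.out.two_le <| show p ^ j = p ^ j' by rw [← hrk, ← hrk', h]
  rw [hI, hI', hjj]

/-- **… and are ISOMORPHIC OVER `G`**: closed subgroup schemes of the same rank factor through each other (★ (o-c3m-a) `exists_comp_eq_iff_le_ker`:
a point of `G` factors through `K` iff its algebra map kills the ideal of `K`), and the two factorisations are inverse since `i`, `i′` are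
monomorphisms. [cite: HarrisTaylorAMS2001, Lemma II.2.1 (2)] [cite: Waterhouse1979, §2.1] -/
theorem exists_iso_of_finrank_alg_eq (θ : (k[X] ⧸ Ideal.span {(X : k[X]) ^ (p ^ N)}) ≃ₐ[k] AffineGroupScheme.Alg G)
    {K' : Over (Spec (.of k))} [GrpObj K'] [IsAffine K'.left]
    (i : K ⟶ G) [IsMonHom i] [IsClosedImmersion i.left] (i' : K' ⟶ G) [IsMonHom i'] [IsClosedImmersion i'.left]
    (h : Module.finrank k (AffineGroupScheme.Alg K) = Module.finrank k (AffineGroupScheme.Alg K')) :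
    ∃ e : K ≅ K', e.hom ≫ i' = i := by
  have hII := ker_eq_ker_of_finrank_alg_eq θ i i' h
  -- `K → G` factors through `K′` and conversely
  obtain ⟨v, hv⟩ := (AffineGroupScheme.exists_comp_eq_iff_le_ker i' ((AffineGroupScheme.isoSpecOver K).inv ≫ i)).mpr (le_of_eq hII.symm)
  obtain ⟨v', hv'⟩ := (AffineGroupScheme.exists_comp_eq_iff_le_ker i ((AffineGroupScheme.isoSpecOver K').inv ≫ i')).mpr (le_of_eq hII)
  let f : K ⟶ K' := (AffineGroupScheme.isoSpecOver K).hom ≫ v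
  let f' : K' ⟶ K := (AffineGroupScheme.isoSpecOver K').hom ≫ v'
  have hf : f ≫ i' = i := by rw [Category.assoc, hv, Iso.hom_inv_id_assoc]
  have hf' : f' ≫ i = i' := by rw [Category.assoc, hv', Iso.hom_inv_id_assoc]
  haveI : Mono i := Over.mono_of_mono_left i
  haveI : Mono i' := Over.mono_of_mono_left i'
  refine ⟨⟨f, f', ?_, ?_⟩, hf⟩
  · rw [← cancel_mono i, Category.assoc, hf', hf, Category.id_comp]
  · rw [← cancel_mono i', Category.assoc, hf, hf', Category.id_comp]

end Scheme

/-! ## §3 (ED. 2) Coordinate-free heads: connected layer with a `k`-point of tangent rank `≤ 1` and rank `p^N` -/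

section CoordinateFree

variable {k : Type u} [Field k] {p : ℕ} [hp : Fact p.Prime] [CharP k p]
  {K G : Over (Spec (.of k))} [GrpObj K] [GrpObj G] [IsAffine K.left] [IsFinite G.hom] [Flat G.hom] {N : ℕ}

/-- **COORDINATE-FREE FORM.**  `G` a finite CONNECTED group scheme over a field `k` of characteristic `p`, with a `k`-point `ε` of tangent rank `≤ 1`
(`dim_k (ker ε)⧸(ker ε)² ≤ 1`) and rank `p^N` (`G.hom.finrank pt = p ^ N`; e.g. `G = 𝒜_x̄[𝔴]` at a supersingular point, rank `q²`): every closed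
subgroup scheme `i : K ↪ G` has `dim_k Γ(K) = p^j` for some `j ≤ N` — the coordinate `θ` of §2 is supplied by ★
`BTGroupConnectedDimOneOfTangentRank.exists_algEquiv_quotient_X_pow_of_connectedSpace`. [cite: HarrisTaylorAMS2001, Lemma II.2.1 (2)] [cite: Tate1997FiniteFlatGroupSchemes, (3.7)] -/
theorem exists_finrank_alg_eq_pow_of_closedSubgroup_of_connectedSpace (hc : ConnectedSpace G.left) (ε : AffineGroupScheme.Alg G →ₐ[k] k)
    (htan : Module.finrank k (RingHom.ker ε.toRingHom).Cotangent ≤ 1) {pt : Spec (.of k)} (hrank : G.hom.finrank pt = p ^ N)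
    (i : K ⟶ G) [IsMonHom i] [IsClosedImmersion i.left] : ∃ j ≤ N, Module.finrank k (AffineGroupScheme.Alg K) = p ^ j := by
  haveI : IsAffine G.left := isAffine_of_isAffineHom G.hom
  obtain ⟨θ₀⟩ := exists_algEquiv_quotient_X_pow_of_connectedSpace G hc ε htan pt
  rw [hrank] at θ₀
  obtain ⟨j, hj, -, hrk⟩ := exists_ker_eq_span_pow_of_closedSubgroup θ₀.symm i
  exact ⟨j, hj, hrk⟩

/-- **COORDINATE-FREE UNIQUENESS: in a finite connected group scheme of tangent rank `≤ 1` over a field of characteristic `p`, two closed subgroup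
schemes of the same rank are ISOMORPHIC OVER `G`** (and have the same ideal) — «the unique subgroup scheme of order `p^t` is `ker F^t`»; the DICT
(b)∕(c3c) supersingular branch. [cite: HarrisTaylorAMS2001, Lemma II.2.1 (2)] [cite: Tate1997FiniteFlatGroupSchemes, (3.7)] -/
theorem exists_iso_of_finrank_alg_eq_of_connectedSpace (hc : ConnectedSpace G.left) (ε : AffineGroupScheme.Alg G →ₐ[k] k)
    (htan : Module.finrank k (RingHom.ker ε.toRingHom).Cotangent ≤ 1) {pt : Spec (.of k)} (hrank : G.hom.finrank pt = p ^ N)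
    {K' : Over (Spec (.of k))} [GrpObj K'] [IsAffine K'.left]
    (i : K ⟶ G) [IsMonHom i] [IsClosedImmersion i.left] (i' : K' ⟶ G) [IsMonHom i'] [IsClosedImmersion i'.left]
    (h : Module.finrank k (AffineGroupScheme.Alg K) = Module.finrank k (AffineGroupScheme.Alg K')) :
    ∃ e : K ≅ K', e.hom ≫ i' = i := by
  haveI : IsAffine G.left := isAffine_of_isAffineHom G.hom
  obtain ⟨θ₀⟩ := exists_algEquiv_quotient_X_pow_of_connectedSpace G hc ε htan pt
  rw [hrank] at θ₀
  exact exists_iso_of_finrank_alg_eq θ₀.symm i i' h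

end CoordinateFree

end Literature.AlgebraicGeometry.GroupSchemes

end
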